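import Literature.AlgebraicGeometry.AbelianSchemes.PoincareSheafBiadditive
import Literature.AlgebraicGeometry.AbelianSchemes.AbelianSchemeOverHomNoetherian
import HarnessLib

/-!
# The Poincaré sheaf is multiplicative in `Â` over a CONNECTED locally Noetherian base (no reducedness):
# `(1_A × g₁g₂)^*𝒫 ≅ (1_A × g₁)^*𝒫 ⊗ (1_A × g₂)^*𝒫`

Layer `Literature/AlgebraicGeometry/AbelianSchemes`, namespace `Literature.AlgebraicGeometry.AbelianSchemes.AbelianSchemeOver`.
THEOREMS ONLY (no definition, no named fact, no instance, no notation).  Cell `hodgecm-mathlib` (D-0151), second-wave item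
(h8) / price-sheet row F-2d «theorem of the square over a possibly NON-REDUCED base», road (R-dual) FILE 1 (author B-p07 (g15);
census `B-provers/B-p07/g15/CENSUS-F2d-CubeOverBase.B-p07g15.md`).  Sequel of ★ `AbelianSchemes/PoincareSheafBiadditive`.

THE POINT.  ★ `PoincareSheafBiadditive` proves, for a dual pair `D = (Â, 𝒫)` of `A/S` ([MilneAV2008, I §8] as an interface)
under the unit hypothesis `hD : 𝒫|_{A × {ε_Â}} ≅ 𝒪`, that the group law of `Â` is the tensor product of rigidified `Pic⁰`
families — `(1_A × g₁g₂)^*𝒫 ≅ (1_A × g₁)^*𝒫 ⊗ (1_A × g₂)^*𝒫` for all `T`-valued points `g₁, g₂ : T → Â` —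
[MumfordAV1970, §8 (p. 75) / §13] «`Â → Pic⁰(A)` is a homomorphism», over a REDUCED locally Noetherian base: reducedness
enters ONLY through the rigidity corollary [MumfordFogartyKirwan1994] Cor. 6.4 («an `S`-morphism of abelian schemes
preserving the unit section is a homomorphism») in its reduced-base form ★ `isMonHom_of_one_comp_of_isReduced_base`.
Since ★ `AbelianSchemeOverHomNoetherian.isMonHom_of_one_comp_of_isLocallyNoetherian` (Cor. 6.4 over a CONNECTED locally
Noetherian base, NO reducedness — from the Stein form of the rigidity lemma, MFK Prop. 6.1), the same proof runs over a
connected locally Noetherian base; this file records it.  The test scheme `T` is arbitrary throughout.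

* §1 `DualPair.nonempty_pullbackP_fst_mul_snd_iso_tensor_of_isLocallyNoetherian` — the classifying morphism
  `m′ : Â ×_S Â → Â` of the family `𝒫_{pr₁} ⊗ 𝒫_{pr₂}` (★ `exists_classify_tensor`, no base hypothesis) kills the unit
  (by `hD`), hence is a homomorphism of the abelian schemes `Â ×_S Â → Â` (Cor. 6.4, connected Noetherian form), is the
  identity on both axes, hence IS the group law (★ `eq_fst_mul_snd_of_isMonHom`):
  `(1_A × pr₁pr₂)^*𝒫 ≅ (1_A × pr₁)^*𝒫 ⊗ (1_A × pr₂)^*𝒫` on `A_{Â ×_S Â}`.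
* §2 **`DualPair.nonempty_pullbackP_mul_iso_of_isLocallyNoetherian`** — pulled back along `1_A × (g₁, g₂)`:
  `(1_A × g₁g₂)^*𝒫 ≅ (1_A × g₁)^*𝒫 ⊗ (1_A × g₂)^*𝒫` on `A_T`, for every `T : Over S` and `g₁, g₂ : T ⟶ Â`
  (for `f : T₀ → S` take `T = Over.mk f`); `DualPair.nonempty_pullbackP_inv_tensor_iso_unit_of_isLocallyNoetherian` —
  `(1_A × g⁻¹)^*𝒫 ⊗ (1_A × g)^*𝒫 ≅ 𝒪` (so `Â(T) → Pic(A_T)` is a group homomorphism).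

HC_CM is proved only modulo the 7 printed citations until rung 0 closes; nothing here is about HC.

## References
* [MumfordAV1970] D. Mumford, *Abelian Varieties* (1970), §8 (pp. 74–75), §13 (p. 125).
* [MilneAV2008] J. S. Milne, *Abelian Varieties* (v2.00, 2008), I §8 pp. 36–37.
* [MumfordFogartyKirwan1994] D. Mumford, J. Fogarty, F. Kirwan, *Geometric Invariant Theory*, 3rd ed. (1994), Ch. 6 §1
  Prop. 6.1 (p. 115), Cor. 6.4 (p. 117).
-/

set_option backward.isDefEq.respectTransparency false

noncomputable section

open CategoryTheory CategoryTheory.Limits AlgebraicGeometry MonoidalCategory CartesianMonoidalCategory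
open scoped MonObj

universe u

namespace Literature.AlgebraicGeometry.AbelianSchemes

open Literature.AlgebraicGeometry.Motives Literature.AlgebraicGeometry.Modules

namespace AbelianSchemeOver

variable {S : Scheme.{u}} {A : AbelianSchemeOver S}

namespace DualPair

variable (D : A.DualPair) [IsLocallyNoetherian S] [PreconnectedSpace S]

/-! ## §1 The classifying morphism of `𝒫_{pr₁} ⊗ 𝒫_{pr₂}` is the group law — connected Noetherian base -/

/-- **THE CLASSIFYING MORPHISM OF `𝒫_{pr₁} ⊗ 𝒫_{pr₂}` IS THE GROUP LAW `pr₁ · pr₂ : Â ×_S Â → Â`** over a CONNECTED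
locally Noetherian base (no reducedness), under the unit hypothesis `hD : 𝒫|_{A × {ε_Â}} ≅ 𝒪`:
`(1_A × pr₁pr₂)^*𝒫 ≅ (1_A × pr₁)^*𝒫 ⊗ (1_A × pr₂)^*𝒫` on `A_{Â ×_S Â}`.  Proof = ★ `nonempty_pullbackP_fst_mul_snd_iso_tensor`
with [MumfordFogartyKirwan1994] Cor. 6.4 in its connected-Noetherian form (★ `isMonHom_of_one_comp_of_isLocallyNoetherian`):
the classifying `m′` kills the unit (by `hD`), is therefore a homomorphism `Â ×_S Â → Â`, is the identity on the two axes,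
hence is `pr₁ · pr₂`.  (Private: the statement coincides textually with the reduced-base ★ one; the public form is §2.)
[cite: MumfordAV1970, §8 (pp. 74–75) and §13 (p. 125)] [cite: MumfordFogartyKirwan1994, Ch. 6 §1 Corollary 6.4 (p. 117)] -/
private theorem nonempty_pullbackP_fst_mul_snd_iso_tensor_of_isLocallyNoetherian
    (hD : Nonempty ((Scheme.Modules.pullback (unitHatSlice D)).obj D.P ≅ SheafOfModules.unit _)) :
    Nonempty (D.pullbackP (D.hat.X ⊗ D.hat.X).hom (fst D.hat.X D.hat.X * snd D.hat.X D.hat.X).left (Over.w _) ≅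
      tensorObj (D.pullbackP (D.hat.X ⊗ D.hat.X).hom (fst D.hat.X D.hat.X).left (Over.w _))
        (D.pullbackP (D.hat.X ⊗ D.hat.X).hom (snd D.hat.X D.hat.X).left (Over.w _))) := by
  obtain ⟨m, hm, hiso, huniq⟩ := D.exists_classify_tensor
  -- `𝒪 ⊗`-absorption of the unit coordinate: `(1_A × (f ≫ ε))^*𝒫 ≅ 𝒪`
  have hunit : ∀ {T : Scheme.{u}} (f : T ⟶ S) (g : T ⟶ D.hat.X.left) (hg : g ≫ D.hat.X.hom = f),
      g = f ≫ D.hat.unitSection → Nonempty (D.pullbackP f g hg ≅ SheafOfModules.unit _) := by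
    intro T f g hg hgf
    have hf : (f ≫ D.hat.unitSection) ≫ D.hat.X.hom = f := by
      rw [Category.assoc, D.hat.unitSection_comp_hom, Category.comp_id]
    rw [D.pullbackP_congr f hgf hg hf]
    exact D.nonempty_pullbackP_comp_unitSection_iso f hD hf
  -- (i) `m′` kills the unit
  have hone : (η[D.hat.X ⊗ D.hat.X]).left ≫ m = (η[D.hat.X]).left := by
    have hu : (η[D.hat.X ⊗ D.hat.X]).left ≫ (D.hat.X ⊗ D.hat.X).hom = 𝟙 S := Over.w _
    have key := huniq (η[D.hat.X ⊗ D.hat.X]).left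
      ((η[D.hat.X ⊗ D.hat.X]).left ≫ (D.hat.X ⊗ D.hat.X).hom ≫ D.hat.unitSection)
      (by rw [Category.assoc, Category.assoc, D.hat.unitSection_comp_hom, Category.comp_id]) ?_
    · rw [← key, ← Category.assoc, hu]; exact Category.id_comp _
    obtain ⟨e₀⟩ := hunit _ ((η[D.hat.X ⊗ D.hat.X]).left ≫ (D.hat.X ⊗ D.hat.X).hom ≫ D.hat.unitSection)
      (by rw [Category.assoc, Category.assoc, D.hat.unitSection_comp_hom, Category.comp_id]) rfl
    obtain ⟨e₁⟩ := hunit _ ((η[D.hat.X ⊗ D.hat.X]).left ≫ (fst D.hat.X D.hat.X).left)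
      (by rw [Category.assoc, Over.w]) (by rw [← Over.comp_left, IsMonHom.one_hom, hu]; exact (Category.id_comp _).symm)
    obtain ⟨e₂⟩ := hunit _ ((η[D.hat.X ⊗ D.hat.X]).left ≫ (snd D.hat.X D.hat.X).left)
      (by rw [Category.assoc, Over.w]) (by rw [← Over.comp_left, IsMonHom.one_hom, hu]; exact (Category.id_comp _).symm)
    exact ⟨e₀ ≪≫ (tensorUnitLeftIso _).symm ≪≫ (tensorMapIso e₁ e₂).symm⟩
  -- (iii) `m′` is the identity on the two axes
  have hinl : (lift (𝟙 D.hat.X) (toUnit _ ≫ η[D.hat.X])).left ≫ m = 𝟙 _ := by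
    have hu : (lift (𝟙 D.hat.X) (toUnit _ ≫ η[D.hat.X])).left ≫ (D.hat.X ⊗ D.hat.X).hom = D.hat.X.hom := Over.w _
    have h1 : (lift (𝟙 D.hat.X) (toUnit _ ≫ η[D.hat.X])).left ≫ (fst D.hat.X D.hat.X).left = 𝟙 _ := by
      rw [← Over.comp_left, lift_fst]; rfl
    have key := huniq (lift (𝟙 D.hat.X) (toUnit _ ≫ η[D.hat.X])).left
      ((lift (𝟙 D.hat.X) (toUnit _ ≫ η[D.hat.X])).left ≫ (fst D.hat.X D.hat.X).left) (by rw [Category.assoc, Over.w]) ?_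
    · rw [← key, h1]
    obtain ⟨e₂⟩ := hunit _ ((lift (𝟙 D.hat.X) (toUnit _ ≫ η[D.hat.X])).left ≫ (snd D.hat.X D.hat.X).left)
      (by rw [Category.assoc, Over.w])
      (by rw [← Over.comp_left, lift_snd, Over.comp_left, Over.toUnit_left, hu])
    exact ⟨(tensorUnitRightIso _).symm ≪≫ (tensorMapIso (Iso.refl _) e₂).symm⟩
  have hinr : (lift (toUnit _ ≫ η[D.hat.X]) (𝟙 D.hat.X)).left ≫ m = 𝟙 _ := by
    have hu : (lift (toUnit _ ≫ η[D.hat.X]) (𝟙 D.hat.X)).left ≫ (D.hat.X ⊗ D.hat.X).hom = D.hat.X.hom := Over.w _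
    have h2 : (lift (toUnit _ ≫ η[D.hat.X]) (𝟙 D.hat.X)).left ≫ (snd D.hat.X D.hat.X).left = 𝟙 _ := by
      rw [← Over.comp_left, lift_snd]; rfl
    have key := huniq (lift (toUnit _ ≫ η[D.hat.X]) (𝟙 D.hat.X)).left
      ((lift (toUnit _ ≫ η[D.hat.X]) (𝟙 D.hat.X)).left ≫ (snd D.hat.X D.hat.X).left) (by rw [Category.assoc, Over.w]) ?_
    · rw [← key, h2]
    obtain ⟨e₁⟩ := hunit _ ((lift (toUnit _ ≫ η[D.hat.X]) (𝟙 D.hat.X)).left ≫ (fst D.hat.X D.hat.X).left)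
      (by rw [Category.assoc, Over.w])
      (by rw [← Over.comp_left, lift_fst, Over.comp_left, Over.toUnit_left, hu])
    exact ⟨(tensorUnitLeftIso _).symm ≪≫ (tensorMapIso e₁ (Iso.refl _)).symm⟩
  -- (ii) + (iv): `m′` is a homomorphism `Â ×_S Â → Â` of abelian schemes (connected Noetherian rigidity), hence the
  -- multiplication
  let P2 : AbelianSchemeOver S :=
    { X := D.hat.X ⊗ D.hat.X
      isProper := isProper_tensorObj_hom D.hat
      isSmooth := smooth_tensorObj_hom D.hat
      geometricallyConnected := geometricallyConnected_tensorObj_hom D.hat }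
  let M : P2.X ⟶ D.hat.X := Over.homMk m hm
  haveI : IsMonHom M :=
    isMonHom_of_one_comp_of_isLocallyNoetherian (A := P2) (B := D.hat) M (Over.OverMorphism.ext hone)
  have hM : M = fst D.hat.X D.hat.X * snd D.hat.X D.hat.X :=
    eq_fst_mul_snd_of_isMonHom D.hat M (Over.OverMorphism.ext hinl) (Over.OverMorphism.ext hinr)
  have hm' : m = (fst D.hat.X D.hat.X * snd D.hat.X D.hat.X).left := by rw [← hM]; rfl
  rw [← D.pullbackP_congr _ hm' hm]
  exact hiso

/-! ## §2 `(1_A × g₁g₂)^*𝒫 ≅ (1_A × g₁)^*𝒫 ⊗ (1_A × g₂)^*𝒫` for `T`-valued points — connected Noetherian base -/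

/-- **THE GROUP LAW OF `Â` IS THE TENSOR PRODUCT OF FAMILIES over a CONNECTED locally Noetherian base** (no reducedness;
[MumfordAV1970, §8]: `Â → Pic⁰(A)` is a homomorphism, over a base): for a dual pair `D = (Â, 𝒫)` of `A/S` satisfying the unit
hypothesis `𝒫|_{A × {ε_Â}} ≅ 𝒪`, any `S`-scheme `T` and any two `T`-valued points `g₁, g₂ : T ⟶ Â` of `Over S` (multiplied
by the group law of `Â`): `(1_A × g₁g₂)^*𝒫 ≅ (1_A × g₁)^*𝒫 ⊗ (1_A × g₂)^*𝒫` on `A_T` — the pull-back of §1 along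
`1_A × (g₁, g₂) : A_T → A_{Â ×_S Â}` (the plumbing of ★ `nonempty_pullbackP_mul_iso`; no hypothesis on `T`).  Stated for
`T : Over S` (the form in which `gᵢ = uᵢ ≫ λ` arise); for `f : T₀ → S` take `T = Over.mk f`.
[cite: MumfordAV1970, §8 (pp. 74–75) and §13 (p. 125)] [cite: MilneAV2008, I §8 pp. 36–37] -/
theorem nonempty_pullbackP_mul_iso_of_isLocallyNoetherian
    (hD : Nonempty ((Scheme.Modules.pullback (unitHatSlice D)).obj D.P ≅ SheafOfModules.unit _))
    {T : Over S} (g₁ g₂ : T ⟶ D.hat.X) :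
    Nonempty (D.pullbackP T.hom (g₁ * g₂).left (Over.w _) ≅
      tensorObj (D.pullbackP T.hom g₁.left (Over.w g₁)) (D.pullbackP T.hom g₂.left (Over.w g₂))) := by
  obtain ⟨I⟩ := D.nonempty_pullbackP_fst_mul_snd_iso_tensor_of_isLocallyNoetherian hD
  -- `1_A × (g₁, g₂) : A_T → A_{Â ×_S Â}`
  have hu : (lift g₁ g₂).left ≫ (D.hat.X ⊗ D.hat.X).hom = T.hom := Over.w _
  obtain ⟨r, hr₁, hr₂⟩ : ∃ r : (A.baseChange T.hom).left ⟶ (A.baseChange (D.hat.X ⊗ D.hat.X).hom).left,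
      r ≫ pullback.fst _ _ = pullback.fst _ _ ∧ r ≫ pullback.snd _ _ = pullback.snd _ _ ≫ (lift g₁ g₂).left :=
    ⟨pullback.lift (pullback.fst _ _) (pullback.snd _ _ ≫ (lift g₁ g₂).left)
      (by rw [pullback.condition, Category.assoc, hu]), pullback.lift_fst _ _ _, pullback.lift_snd _ _ _⟩
  have hr : ∀ (g : (D.hat.X ⊗ D.hat.X).left ⟶ D.hat.X.left) (hg : g ≫ D.hat.X.hom = (D.hat.X ⊗ D.hat.X).hom),
      r ≫ A.baseChangeToProd D.hat _ g hg =
        A.baseChangeToProd D.hat T.hom ((lift g₁ g₂).left ≫ g) (by rw [Category.assoc, hg, hu]) := by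
    intro g hg
    apply pullback.hom_ext
    · rw [Category.assoc, baseChangeToProd_fst, baseChangeToProd_fst, hr₁]
    · rw [Category.assoc, baseChangeToProd_snd, baseChangeToProd_snd, ← Category.assoc, hr₂, Category.assoc]
  -- `(1_A × (g₁,g₂))^* (1_A × g)^* 𝒫 ≅ (1_A × ((g₁,g₂) ≫ g))^* 𝒫`
  have e : ∀ (g : (D.hat.X ⊗ D.hat.X).left ⟶ D.hat.X.left) (hg : g ≫ D.hat.X.hom = (D.hat.X ⊗ D.hat.X).hom),
      (Scheme.Modules.pullback r).obj (D.pullbackP _ g hg) ≅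
        D.pullbackP T.hom ((lift g₁ g₂).left ≫ g) (by rw [Category.assoc, hg, hu]) := fun g hg =>
    (Scheme.Modules.pullbackComp _ _).app D.P ≪≫ (Scheme.Modules.pullbackCongr (hr g hg)).app D.P
  have h12 : (lift g₁ g₂).left ≫ (fst D.hat.X D.hat.X * snd D.hat.X D.hat.X).left = (g₁ * g₂).left := by
    rw [← Over.comp_left, MonObj.comp_mul, lift_fst, lift_snd]
  have h1 : (lift g₁ g₂).left ≫ (fst D.hat.X D.hat.X).left = g₁.left := by rw [← Over.comp_left, lift_fst]
  have h2 : (lift g₁ g₂).left ≫ (snd D.hat.X D.hat.X).left = g₂.left := by rw [← Over.comp_left, lift_snd]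
  refine ⟨?_⟩
  rw [← D.pullbackP_congr T.hom h12 (by rw [Category.assoc, Over.w, hu]) (Over.w _),
    ← D.pullbackP_congr T.hom h1 (by rw [Category.assoc, Over.w, hu]) (Over.w g₁),
    ← D.pullbackP_congr T.hom h2 (by rw [Category.assoc, Over.w, hu]) (Over.w g₂)]
  exact (e _ (Over.w _)).symm ≪≫ (Scheme.Modules.pullback r).mapIso I ≪≫
    pullbackTensorIso r (HasRank.isFiniteLocallyFree' (D.hasRank_one_pullbackP _ _ (Over.w _)))
      (HasRank.isFiniteLocallyFree' (D.hasRank_one_pullbackP _ _ (Over.w _))) ≪≫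
    tensorMapIso (e _ (Over.w _)) (e _ (Over.w _))

/-- The same over a structure morphism `f : T → S` (`T` a scheme, `g₁ g₂ : Over.mk f ⟶ Â`), together with the INVERSE:
`(1_A × g⁻¹)^*𝒫 ⊗ (1_A × g)^*𝒫 ≅ 𝒪` — `Â(T) → Pic(A_T)` is a group homomorphism (unit: `hD`; [MumfordAV1970, §8 (p. 75)]).
[cite: MumfordAV1970, §8 (pp. 74–75) and §13 (p. 125)] [cite: MilneAV2008, I §8 pp. 36–37] -/
theorem nonempty_pullbackP_inv_tensor_iso_unit_of_isLocallyNoetherian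
    (hD : Nonempty ((Scheme.Modules.pullback (unitHatSlice D)).obj D.P ≅ SheafOfModules.unit _))
    {T : Over S} (g : T ⟶ D.hat.X) :
    Nonempty (tensorObj (D.pullbackP T.hom (g⁻¹).left (Over.w _)) (D.pullbackP T.hom g.left (Over.w g)) ≅
      SheafOfModules.unit _) := by
  obtain ⟨I⟩ := D.nonempty_pullbackP_mul_iso_of_isLocallyNoetherian hD g⁻¹ g
  -- `g⁻¹ · g = 1 = toUnit ≫ ε`, whose underlying morphism is `T.hom ≫ ε_Â`; and `(1_A × (T.hom ≫ ε_Â))^*𝒫 ≅ 𝒪` by `hD`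
  have hε : (g⁻¹ * g).left = T.hom ≫ D.hat.unitSection := by
    rw [inv_mul_cancel, Hom.one_def, Over.comp_left, Over.toUnit_left]
  have hf : (T.hom ≫ D.hat.unitSection) ≫ D.hat.X.hom = T.hom := by
    rw [Category.assoc, D.hat.unitSection_comp_hom, Category.comp_id]
  obtain ⟨J⟩ := D.nonempty_pullbackP_comp_unitSection_iso T.hom hD hf
  rw [D.pullbackP_congr T.hom hε (Over.w _) hf] at I
  exact ⟨I.symm ≪≫ J⟩

end DualPair



end AbelianSchemeOver

end Literature.AlgebraicGeometry.AbelianSchemes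

end
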